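import Summits.QuantumFields.YangMills.Theorems.PoincareLipschitzSphereMapSmallEnergyUnmollified
import Summits.QuantumFields.YangMills.Theorems.PoincareLipschitzSphereMapNearSphereFromBands
import Summits.QuantumFields.YangMills.Theorems.PoincareLipschitzMultiScaleGoodShell

/-!
# Line «poincare_lipschitz» on crux `HistoryTailL` (stmt-QuantumFields-19936), route crux `BlockLipschitzL` (stmt-QuantumFields-23533), K2 organ of record LOC-REG-MIN —
# FLAT SHADOW «ENERGY → RANGE» (E→R) FOR LATTICE MINIMISERS INTO A SPHERE, FILE 5d-F3b (d = 3): THE MOLLIFIED ONE STEP (regime of SCALE-INVARIANTLY small energy) —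
# px8's ✓F3 dyadic good shell `r′ ∈ [p, q]` (`n+3` bands) + ✓F5d-F3a near-sphere∕band suppliers + ✓`oneStep_tent` at `R = r′ − 2^{n+2}` (tent scale `s = 2^n`):
# `E_ρ ≤ 10¹⁴((ρ+1)∕(R−1))³E_r + 2·sl + 8η·E_r + 10¹¹·X + 8·10⁵·√(E_r·X)`, `X = 2^{n+3}·G`, `G = 12(n+3)²E_r∕(q−p+1)`, for `0 ≤ ρ ≤ R − 2`,
# under the single displayed smallness `6r√(E_r∕a³) + 2a√(3E_r∕a³) + 2√(6G) ≤ η ≤ ¼`, `a = 2^{n+1} + 1`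

Cell `ym3-torus` (YM ladder rung R3 = continuum SU(2) Yang–Mills on the three-torus — a RUNG, NOT the Clay problem: not d = 4, not infinite volume, not a mass gap); width seat
`ym-ust-19936-w5` gen 12 (LEAD ym-ust-19936-w1 g9 2026-08-29T06:49:23Z DISPLAYED `hC` 2e0c4712bb15d94d — this file is regime (a) of my 06:51:10Z answer).  THEOREMS ONLY
(def-free), `d = 3`, `V` finite-dimensional real inner-product space; `--supports stmt-QuantumFields-19936`.  Nothing here proves `hC`, px8's `hone`, E→R, LOC-REG-MIN, `hReg`,
`hImprove`, a stub, `BlockLipschitzL`, `HistoryTailL` or a summit statement.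
* §1 numeric letters (`2A₃ ≤ 10¹⁴`, `C₆ ≤ 4·10⁹`, the tent scale `⌊2^{n+2}∕4⌋ = 2^n`);
* §2 ★★★ `oneStep_mollified`.
[folklore] ([SchoenUhlenbeck1982] §4 small-energy improvement with the mollified comparison map; [Giaquinta1984] Ch. III direct comparison; the lattice statement is this file's).
-/

set_option autoImplicit false

noncomputable section

open scoped BigOperators InnerProductSpace
open Finset

namespace Summit.QuantumFields.YangMills.Theorems.PoincareLipschitzSphereMapSmallEnergyMollified

open Literature.MathematicalPhysics.QuantumFieldTheory.Balaban1983to89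
open B4Eq19LatticeOperators
open Summit.QuantumFields.YangMills.Theorems.PoincareLipschitzSphereMapTentOneStep (oneStep_tent)
open Summit.QuantumFields.YangMills.Theorems.PoincareLipschitzSphereMapSmallEnergyUnmollified (inv_sq_sub_one_le sum_box_le_sum_box)
open Summit.QuantumFields.YangMills.Theorems.PoincareLipschitzSphereMapNearSphereFromBands (norm_tentMollifier_ge_of_bands energy_U_le_of_bands)
open Summit.QuantumFields.YangMills.Theorems.PoincareLipschitzMultiScaleGoodShell (exists_goodRadius_dyadic)

variable {V : Type*} [NormedAddCommGroup V] [InnerProductSpace ℝ V]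

/-! ## §1 Numeric letters -/

/-- `2·A₃ ≤ 10¹⁴`, `A₃ = 2³(1+56·3)³(8·4)⁴` the constant of px7's ✓`vec_harmonic_decay` at `d = 3`. [folklore] -/
theorem two_mul_decayConst_three_le :
    2 * ((2 : ℝ) ^ 3 * (1 + 56 * ((3 : ℕ) : ℝ)) ^ 3 * (8 * (((3 : ℕ) : ℝ) + 1)) ^ (3 + 1)) ≤ (10 : ℝ) ^ 14 := by
  norm_num

/-- `C₆ ≤ 4·10⁹`, `C₆ = 3·(2+4·3)²·3·21³·6³` the tent-mollifier energy constant of ✓`oneStep_tent` at `d = 3`. [folklore] -/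
theorem mollifierConst_three_le :
    ((3 : ℕ) : ℝ) * ((2 + 4 * ((3 : ℕ) : ℝ)) ^ 2 * ((3 : ℕ) : ℝ) * (21 : ℝ) ^ 3) * (((2 : ℕ) : ℝ) + (3 : ℕ) + 1) ^ 3 ≤ 4 * (10 : ℝ) ^ 9 := by
  norm_num

/-- The tent scale: `⌊(2^{n+2})₊ ∕ 4⌋ = 2^n`. [folklore] -/
theorem toNat_two_pow_div_four (n : ℕ) : (((2 : ℤ) ^ (n + 2)).toNat / 4 : ℕ) = 2 ^ n := by
  have h1 : ((2 : ℤ) ^ (n + 2)) = ((2 ^ (n + 2) : ℕ) : ℤ) := by push_cast; ring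
  rw [h1, Int.toNat_natCast, pow_add]
  norm_num

/-- The real-arithmetic bookkeeping behind ✓`oneStep_tent` ⟶ `oneStep_mollified`: `2A₃ ≤ 10¹⁴`, `C₆ ≤ 4·10⁹`, `E_R ≤ E_r`, `E_U ≤ X`, `m = 1 − η` with
`0 ≤ η ≤ ¼` (`(m²)⁻¹ − 1 ≤ 4η`, `(m²)⁻¹ ≤ 2`). [folklore] -/
theorem oneStep_bookkeeping {A C f ER E EU X sl η : ℝ} (hA : 2 * A ≤ (10 : ℝ) ^ 14) (hA0 : 0 ≤ A) (hC : C ≤ 4 * (10 : ℝ) ^ 9) (hC0 : 0 ≤ C)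
    (hf0 : 0 ≤ f) (hER : ER ≤ E) (hER0 : 0 ≤ ER) (hEU : EU ≤ X) (hEU0 : 0 ≤ EU) (hη0 : 0 ≤ η) (hη4 : η ≤ 1 / 4) :
    2 * (A * f) * ER + 2 * (sl + 4 * C * EU + (((1 - η) ^ 2)⁻¹ - 1) * ER +
        ((1 - η) ^ 2)⁻¹ * (2 * Real.sqrt (ER * ((2 * C + 2) * EU)) + (2 * C + 2) * EU)) ≤
      (10 : ℝ) ^ 14 * f * E + 2 * sl + 8 * η * E + (10 : ℝ) ^ 11 * X + 8 * (10 : ℝ) ^ 5 * Real.sqrt (E * X) := by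
  have hE0 : 0 ≤ E := hER0.trans hER
  have hX0 : 0 ≤ X := hEU0.trans hEU
  have hinv : ((1 - η) ^ 2)⁻¹ - 1 ≤ 4 * η := inv_sq_sub_one_le hη0 hη4
  have hm1 : 0 < 1 - η := by linarith
  have hm2 : 0 < (1 - η) ^ 2 := by positivity
  have hinv2 : ((1 - η) ^ 2)⁻¹ ≤ 2 := by
    rw [inv_le_comm₀ hm2 (by norm_num)]
    nlinarith
  have t1 : 2 * (A * f) * ER ≤ (10 : ℝ) ^ 14 * f * E := by
    calc 2 * (A * f) * ER ≤ 2 * (A * f) * E := mul_le_mul_of_nonneg_left hER (by positivity)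
      _ = (2 * A) * (f * E) := by ring
      _ ≤ (10 : ℝ) ^ 14 * (f * E) := mul_le_mul_of_nonneg_right hA (mul_nonneg hf0 hE0)
      _ = (10 : ℝ) ^ 14 * f * E := by ring
  have t2 : C * EU ≤ 4 * (10 : ℝ) ^ 9 * X := mul_le_mul hC hEU hEU0 (by positivity)
  have t3 : (((1 - η) ^ 2)⁻¹ - 1) * ER ≤ 4 * η * E := mul_le_mul hinv hER hER0 (by positivity)
  have t4b : (2 * C + 2) * EU ≤ (10 : ℝ) ^ 10 * X := mul_le_mul (by linarith) hEU hEU0 (by positivity)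
  have t4a : Real.sqrt (ER * ((2 * C + 2) * EU)) ≤ (10 : ℝ) ^ 5 * Real.sqrt (E * X) := by
    have h1 : ER * ((2 * C + 2) * EU) ≤ (10 : ℝ) ^ 10 * (E * X) := by
      calc ER * ((2 * C + 2) * EU) ≤ E * ((10 : ℝ) ^ 10 * X) := mul_le_mul hER t4b (by positivity) hE0
        _ = (10 : ℝ) ^ 10 * (E * X) := by ring
    calc Real.sqrt (ER * ((2 * C + 2) * EU)) ≤ Real.sqrt ((10 : ℝ) ^ 10 * (E * X)) := Real.sqrt_le_sqrt h1
      _ = (10 : ℝ) ^ 5 * Real.sqrt (E * X) := by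
        rw [Real.sqrt_mul (by positivity), show (10 : ℝ) ^ 10 = ((10 : ℝ) ^ 5) ^ 2 by norm_num,
          Real.sqrt_sq (by positivity)]
  have t4 : ((1 - η) ^ 2)⁻¹ * (2 * Real.sqrt (ER * ((2 * C + 2) * EU)) + (2 * C + 2) * EU) ≤
      2 * (2 * ((10 : ℝ) ^ 5 * Real.sqrt (E * X)) + (10 : ℝ) ^ 10 * X) :=
    mul_le_mul hinv2 (by linarith) (by positivity) (by norm_num)
  nlinarith [t1, t2, t3, t4, hX0, Real.sqrt_nonneg (E * X)]

/-! ## §2 The mollified one step -/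
set_option maxHeartbeats 400000 in
/-- ★★★ **THE MOLLIFIED ONE STEP** (`d = 3`).  `u : ℤ³ → V` unit-valued, almost minimising on `Q_r(z)` with constant slack `sl` against unit competitors agreeing with `u` off
`Q_{r−1}(z)`; radii `2^{n+2} + 2 ≤ p ≤ q ≤ r`; `E_r := E(u;Q_r(z))`, `G := 12(n+3)²·E_r∕(q−p+1)`, `a := 2^{n+1} + 1`; ONE displayed smallness
`6r·√(E_r∕a³) + 2a·√(3E_r∕a³) + 2√(6G) ≤ η ≤ ¼`.  THEN there is `R ∈ [p − 2^{n+2}, q − 2^{n+2}]` (namely `r′ − 2^{n+2}`, `r′` px8's good radius) with, for every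
`0 ≤ ρ ≤ R − 2`:  `E(u;Q_ρ(z)) ≤ 10¹⁴·((ρ+1)∕(R−1))³·E_r + 2·sl + 8η·E_r + 10¹¹·(2^{n+3}G) + 8·10⁵·√(E_r·(2^{n+3}G))`.
PROOF: ✓`exists_goodRadius_dyadic` (bands `k < n+3`, `(k+1)² ≤ (n+3)²`) ⇒ ✓`norm_tentMollifier_ge_of_bands` (`‖c‖ ≥ 1 − 2√(6G) ≥ 1 − η =: m ≥ ¾` off `Q_{R−1}`),
✓`energy_U_le_of_bands` (`E_U ≤ 2^{n+3}G`), the ring defect of ✓`oneStep_tent`'s `hmH` at scale `s = 2^n` bounded through `R ≤ r`, `E(Q_{R+s+1}) ≤ E_r`; then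
✓`oneStep_tent`, `(m²)⁻¹ − 1 ≤ 4η`, `(m²)⁻¹ ≤ 2`, `E_R ≤ E_r`, §1. [folklore]
[cite: SchoenUhlenbeck1982, §4] -/
theorem oneStep_mollified [FiniteDimensional ℝ V] (u : Zd 3 → V) (z : Zd 3) {r p q : ℤ} {n : ℕ}
    (hpq : p ≤ q) (hqr : q ≤ r) (hp : (2 : ℤ) ^ (n + 2) + 2 ≤ p)
    (hu : ∀ y, ‖u y‖ = 1)
    {sl : ℝ} (hminU : ∀ w : Zd 3 → V, (∀ y, ‖w y‖ = 1) → (∀ y ∉ box z (r - 1), w y = u y) →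
      ∑ y ∈ box z r, ∑ μ, ‖u (y + unitVec μ) - u y‖ ^ 2 ≤ ∑ y ∈ box z r, ∑ μ, ‖w (y + unitVec μ) - w y‖ ^ 2 + sl)
    {η : ℝ}
    (hη : 6 * (r : ℝ) * Real.sqrt (((((2 : ℝ) ^ (n + 1) + 1) ^ 3))⁻¹ * ∑ y ∈ box z r, ∑ μ, ‖u (y + unitVec μ) - u y‖ ^ 2) +
        2 * ((2 : ℝ) ^ (n + 1) + 1) * Real.sqrt (3 * ((((2 : ℝ) ^ (n + 1) + 1) ^ 3))⁻¹ * ∑ y ∈ box z r, ∑ μ, ‖u (y + unitVec μ) - u y‖ ^ 2) +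
        2 * Real.sqrt (6 * (12 * ((n : ℝ) + 3) ^ 2 * (∑ y ∈ box z r, ∑ μ, ‖u (y + unitVec μ) - u y‖ ^ 2) / (((q - p + 1 : ℤ) : ℝ)))) ≤ η)
    (hη4 : η ≤ 1 / 4) :
    ∃ R : ℤ, p - (2 : ℤ) ^ (n + 2) ≤ R ∧ R ≤ q - (2 : ℤ) ^ (n + 2) ∧ ∀ ρ : ℤ, 0 ≤ ρ → ρ ≤ R - 2 →
      ∑ y ∈ box z ρ, ∑ μ, ‖u (y + unitVec μ) - u y‖ ^ 2 ≤
        (10 : ℝ) ^ 14 * (((ρ : ℝ) + 1) / ((R : ℝ) - 1)) ^ 3 * ∑ y ∈ box z r, ∑ μ, ‖u (y + unitVec μ) - u y‖ ^ 2 + 2 * sl +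
          8 * η * ∑ y ∈ box z r, ∑ μ, ‖u (y + unitVec μ) - u y‖ ^ 2 +
          (10 : ℝ) ^ 11 * ((2 : ℝ) ^ (n + 3) * (12 * ((n : ℝ) + 3) ^ 2 * (∑ y ∈ box z r, ∑ μ, ‖u (y + unitVec μ) - u y‖ ^ 2) / (((q - p + 1 : ℤ) : ℝ)))) +
          8 * (10 : ℝ) ^ 5 * Real.sqrt ((∑ y ∈ box z r, ∑ μ, ‖u (y + unitVec μ) - u y‖ ^ 2) *
            ((2 : ℝ) ^ (n + 3) * (12 * ((n : ℝ) + 3) ^ 2 * (∑ y ∈ box z r, ∑ μ, ‖u (y + unitVec μ) - u y‖ ^ 2) / (((q - p + 1 : ℤ) : ℝ))))) := by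
  -- letters
  have hqp0 : (0 : ℝ) < ((q - p + 1 : ℤ) : ℝ) := by exact_mod_cast (by omega : (0 : ℤ) < q - p + 1)
  -- px8's good radius
  obtain ⟨r', hr'I, hgood0⟩ := exists_goodRadius_dyadic z r hpq hqr (n + 3) (fun y => ∑ μ, ‖u (y + unitVec μ) - u y‖ ^ 2)
    (fun y _ => Finset.sum_nonneg fun _ _ => by positivity)
  rw [Finset.mem_Icc] at hr'I
  obtain ⟨hpr', hr'q⟩ := hr'I
  have hgood : ∀ k ≤ n + 2, ∑ w ∈ box z (r' - (2 : ℤ) ^ k) \ box z (r' - (2 : ℤ) ^ (k + 2)), ∑ μ, ‖u (w + unitVec μ) - u w‖ ^ 2 ≤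
      (12 * ((n : ℝ) + 3) ^ 2 * (∑ y ∈ box z r, ∑ μ, ‖u (y + unitVec μ) - u y‖ ^ 2) / (((q - p + 1 : ℤ) : ℝ))) * (2 : ℝ) ^ k := by
    intro k hk
    have h1 := hgood0 k (by omega)
    change ((q - p + 1 : ℤ) : ℝ) * ∑ w ∈ box z (r' - (2 : ℤ) ^ k) \ box z (r' - (2 : ℤ) ^ (k + 2)), ∑ μ, ‖u (w + unitVec μ) - u w‖ ^ 2 ≤
      4 * ((k : ℝ) + 1) ^ 2 * ((3 * (2 : ℝ) ^ k) * (∑ y ∈ box z r, ∑ μ, ‖u (y + unitVec μ) - u y‖ ^ 2)) at h1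
    have hk' : ((k : ℝ) + 1) ^ 2 ≤ ((n : ℝ) + 3) ^ 2 := by
      have : (k : ℝ) + 1 ≤ (n : ℝ) + 3 := by
        have : (k : ℝ) ≤ (n : ℝ) + 2 := by exact_mod_cast hk
        linarith
      exact pow_le_pow_left₀ (by positivity) this 2
    have h2 : 4 * ((k : ℝ) + 1) ^ 2 * ((3 * (2 : ℝ) ^ k) * (∑ y ∈ box z r, ∑ μ, ‖u (y + unitVec μ) - u y‖ ^ 2)) ≤
        4 * ((n : ℝ) + 3) ^ 2 * ((3 * (2 : ℝ) ^ k) * (∑ y ∈ box z r, ∑ μ, ‖u (y + unitVec μ) - u y‖ ^ 2)) :=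
      mul_le_mul_of_nonneg_right (mul_le_mul_of_nonneg_left hk' (by norm_num)) (by positivity)
    rw [div_mul_eq_mul_div, le_div_iff₀ hqp0]
    calc (∑ w ∈ box z (r' - (2 : ℤ) ^ k) \ box z (r' - (2 : ℤ) ^ (k + 2)), ∑ μ, ‖u (w + unitVec μ) - u w‖ ^ 2) * (((q - p + 1 : ℤ) : ℝ))
        = ((q - p + 1 : ℤ) : ℝ) * ∑ w ∈ box z (r' - (2 : ℤ) ^ k) \ box z (r' - (2 : ℤ) ^ (k + 2)), ∑ μ, ‖u (w + unitVec μ) - u w‖ ^ 2 := mul_comm _ _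
      _ ≤ 4 * ((n : ℝ) + 3) ^ 2 * ((3 * (2 : ℝ) ^ k) * (∑ y ∈ box z r, ∑ μ, ‖u (y + unitVec μ) - u y‖ ^ 2)) := h1.trans h2
      _ = 12 * ((n : ℝ) + 3) ^ 2 * (∑ y ∈ box z r, ∑ μ, ‖u (y + unitVec μ) - u y‖ ^ 2) * (2 : ℝ) ^ k := by ring
  set E := ∑ y ∈ box z r, ∑ μ, ‖u (y + unitVec μ) - u y‖ ^ 2 with hE
  have hE0 : 0 ≤ E := Finset.sum_nonneg fun _ _ => Finset.sum_nonneg fun _ _ => by positivity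
  set G := 12 * ((n : ℝ) + 3) ^ 2 * E / (((q - p + 1 : ℤ) : ℝ)) with hG
  have hG0 : 0 ≤ G := by positivity
  set X := (2 : ℝ) ^ (n + 3) * G with hX
  have hX0 : 0 ≤ X := by positivity
  set a : ℝ := (2 : ℝ) ^ (n + 1) + 1 with ha
  have ha0 : 0 < a := by positivity
  have hsq0 : 0 ≤ 2 * Real.sqrt (6 * G) := by positivity
  have hring0 : 0 ≤ 6 * (r : ℝ) * Real.sqrt ((a ^ 3)⁻¹ * E) + 2 * a * Real.sqrt (3 * (a ^ 3)⁻¹ * E) := by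
    have : (0 : ℝ) ≤ r := by exact_mod_cast (by linarith [hp, hpq, hqr, (by positivity : (0 : ℤ) < (2 : ℤ) ^ (n + 2))] : (0 : ℤ) ≤ r)
    positivity
  have hη0 : 0 ≤ η := (add_nonneg hring0 hsq0).trans hη
  have h2G : 2 * Real.sqrt (6 * G) ≤ η := (le_add_of_nonneg_left hring0).trans hη
  -- the radii
  set R : ℤ := r' - (2 : ℤ) ^ (n + 2) with hRdef
  have h2n : (0 : ℤ) < (2 : ℤ) ^ n := by positivity
  have h2n2 : (2 : ℤ) ^ (n + 2) = 4 * (2 : ℤ) ^ n := by ring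
  have hR2 : 2 ≤ R := by rw [hRdef]; linarith
  have hRr' : R ≤ r' := by rw [hRdef]; linarith [h2n]
  have hs : ((r' - R).toNat / 4 : ℕ) = 2 ^ n := by
    have : r' - R = (2 : ℤ) ^ (n + 2) := by rw [hRdef]; ring
    rw [this]; exact toNat_two_pow_div_four n
  refine ⟨R, by rw [hRdef]; linarith, by rw [hRdef]; linarith, fun ρ hρ hρR => ?_⟩
  -- the tent mollifier and its near-sphere data
  set c : Zd 3 → V := fun y => (((box y ((((min (r' - ((Finset.univ.sup fun j => (y j - z j).natAbs : ℕ) : ℤ))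
        (((Finset.univ.sup fun j => (y j - z j).natAbs : ℕ) : ℤ) - (2 * R - r'))).toNat / 4 : ℕ) : ℤ))).card : ℝ))⁻¹ •
      ∑ w ∈ box y ((((min (r' - ((Finset.univ.sup fun j => (y j - z j).natAbs : ℕ) : ℤ))
        (((Finset.univ.sup fun j => (y j - z j).natAbs : ℕ) : ℤ) - (2 * R - r'))).toNat / 4 : ℕ) : ℤ)), u w with hcdef
  have hc : ∀ y, c y = (((box y ((((min (r' - ((Finset.univ.sup fun j => (y j - z j).natAbs : ℕ) : ℤ))
        (((Finset.univ.sup fun j => (y j - z j).natAbs : ℕ) : ℤ) - (2 * R - r'))).toNat / 4 : ℕ) : ℤ))).card : ℝ))⁻¹ •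
      ∑ w ∈ box y ((((min (r' - ((Finset.univ.sup fun j => (y j - z j).natAbs : ℕ) : ℤ))
        (((Finset.univ.sup fun j => (y j - z j).natAbs : ℕ) : ℤ) - (2 * R - r'))).toNat / 4 : ℕ) : ℤ)), u w := fun y => rfl
  have hnear : ∀ y ∉ box z (R - 1), 1 - 2 * Real.sqrt (6 * G) ≤ ‖c y‖ := fun y hy =>
    norm_tentMollifier_ge_of_bands u c z (n := n + 2) hRdef hu hc hG0 hgood hy
  have hm : 0 < 1 - η := by linarith
  have hm1 : 1 - η ≤ 1 := by linarith
  have hR1 : 1 ≤ R := by linarith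
  -- the ring defect at scale `s = 2^n`
  have hE' : ∑ w ∈ box z (R + ((2 ^ n : ℕ) : ℤ) + 1), ∑ μ, ‖u (w + unitVec μ) - u w‖ ^ 2 ≤ E := by
    rw [hE]; refine sum_box_le_sum_box u z ?_; push_cast; rw [hRdef]; linarith
  have hE'0 : 0 ≤ ∑ w ∈ box z (R + ((2 ^ n : ℕ) : ℤ) + 1), ∑ μ, ‖u (w + unitVec μ) - u w‖ ^ 2 :=
    Finset.sum_nonneg fun _ _ => Finset.sum_nonneg fun _ _ => by positivity
  have hacast : (((2 * ((2 ^ n : ℕ) : ℤ) + 1 : ℤ) : ℝ)) = a := by rw [ha]; push_cast; ring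
  have hRle : (R : ℝ) ≤ r := by exact_mod_cast (by linarith : R ≤ r)
  have hR0 : (0 : ℝ) ≤ R := by exact_mod_cast (by linarith : (0 : ℤ) ≤ R)
  have hmH : 1 - η ≤ 1 - (2 * ((3 : ℕ) : ℝ) * R * Real.sqrt (((a ^ 3))⁻¹ * ∑ w ∈ box z (R + ((2 ^ n : ℕ) : ℤ) + 1), ∑ μ, ‖u (w + unitVec μ) - u w‖ ^ 2) +
      2 * a * Real.sqrt (((3 : ℕ) : ℝ) * ((a ^ 3))⁻¹ * ∑ w ∈ box z (R + ((2 ^ n : ℕ) : ℤ) + 1), ∑ μ, ‖u (w + unitVec μ) - u w‖ ^ 2)) := by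
    have ha3 : 0 ≤ (a ^ 3)⁻¹ := by positivity
    have h1 : Real.sqrt ((a ^ 3)⁻¹ * ∑ w ∈ box z (R + ((2 ^ n : ℕ) : ℤ) + 1), ∑ μ, ‖u (w + unitVec μ) - u w‖ ^ 2) ≤ Real.sqrt ((a ^ 3)⁻¹ * E) :=
      Real.sqrt_le_sqrt (mul_le_mul_of_nonneg_left hE' ha3)
    have h2 : Real.sqrt (((3 : ℕ) : ℝ) * (a ^ 3)⁻¹ * ∑ w ∈ box z (R + ((2 ^ n : ℕ) : ℤ) + 1), ∑ μ, ‖u (w + unitVec μ) - u w‖ ^ 2) ≤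
        Real.sqrt (3 * (a ^ 3)⁻¹ * E) := by
      have e : ((3 : ℕ) : ℝ) = 3 := by norm_num
      rw [e]; exact Real.sqrt_le_sqrt (mul_le_mul_of_nonneg_left hE' (by positivity))
    have h3 : 2 * ((3 : ℕ) : ℝ) * R * Real.sqrt ((a ^ 3)⁻¹ * ∑ w ∈ box z (R + ((2 ^ n : ℕ) : ℤ) + 1), ∑ μ, ‖u (w + unitVec μ) - u w‖ ^ 2) ≤
        6 * (r : ℝ) * Real.sqrt ((a ^ 3)⁻¹ * E) := by
      have e : ((3 : ℕ) : ℝ) = 3 := by norm_num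
      rw [e]
      calc 2 * (3 : ℝ) * R * Real.sqrt ((a ^ 3)⁻¹ * ∑ w ∈ box z (R + ((2 ^ n : ℕ) : ℤ) + 1), ∑ μ, ‖u (w + unitVec μ) - u w‖ ^ 2)
          ≤ 2 * 3 * R * Real.sqrt ((a ^ 3)⁻¹ * E) := mul_le_mul_of_nonneg_left h1 (by positivity)
        _ ≤ 2 * 3 * (r : ℝ) * Real.sqrt ((a ^ 3)⁻¹ * E) := by
          have := Real.sqrt_nonneg ((a ^ 3)⁻¹ * E)
          nlinarith
        _ = 6 * (r : ℝ) * Real.sqrt ((a ^ 3)⁻¹ * E) := by ring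
    have h4 : 2 * a * Real.sqrt (((3 : ℕ) : ℝ) * (a ^ 3)⁻¹ * ∑ w ∈ box z (R + ((2 ^ n : ℕ) : ℤ) + 1), ∑ μ, ‖u (w + unitVec μ) - u w‖ ^ 2) ≤
        2 * a * Real.sqrt (3 * (a ^ 3)⁻¹ * E) := mul_le_mul_of_nonneg_left h2 (by positivity)
    have h5 : 6 * (r : ℝ) * Real.sqrt ((a ^ 3)⁻¹ * E) + 2 * a * Real.sqrt (3 * (a ^ 3)⁻¹ * E) + 2 * Real.sqrt (6 * G) ≤ η := hη
    linarith
  -- the one step (taken NOW: once the large `h` is in scope no context-scanning tactic is run, and no comparison hypothesis mentioning `c` is ever named)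
  have hr'r : r' ≤ r := hr'q.trans hqr
  have hRr : R ≤ r := hRr'.trans hr'r
  have h := oneStep_tent (d := 3) (by norm_num) u c z (r := r) (r' := r') (R := R) hu hc hR1 hRr' hr'r hminU
    (fun y hy => by linarith [hnear y hy]) hm hm1 (fun y _ hy => by linarith [hnear y hy]) (by rw [hs, hacast]; exact hmH) hρ hρR
  -- bookkeeping (term-mode ∕ `ring` ∕ `positivity` only)
  have hU : box z (r' - 1) \ box z (2 * R - r') = box z (r' - 1) \ box z (r' - (2 : ℤ) ^ (n + 3)) := by
    congr 2; rw [hRdef]; ring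
  have hEU : ∑ y ∈ box z (r' - 1) \ box z (2 * R - r'), ∑ μ, ‖u (y + unitVec μ) - u y‖ ^ 2 ≤ X := by
    rw [hU, hX]
    have := energy_U_le_of_bands u z r' (n + 2) hG0 hgood
    rw [show n + 2 + 1 = n + 3 from rfl] at this
    exact this
  have hEU0 : 0 ≤ ∑ y ∈ box z (r' - 1) \ box z (2 * R - r'), ∑ μ, ‖u (y + unitVec μ) - u y‖ ^ 2 :=
    Finset.sum_nonneg fun _ _ => Finset.sum_nonneg fun _ _ => by positivity
  have hER : ∑ y ∈ box z R, ∑ μ, ‖u (y + unitVec μ) - u y‖ ^ 2 ≤ E := by rw [hE]; exact sum_box_le_sum_box u z hRr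
  have hER0 : 0 ≤ ∑ y ∈ box z R, ∑ μ, ‖u (y + unitVec μ) - u y‖ ^ 2 := Finset.sum_nonneg fun _ _ => Finset.sum_nonneg fun _ _ => by positivity
  have hden : (((R - 2 : ℤ) : ℝ) + 1) = (R : ℝ) - 1 := by push_cast; ring
  have hf0 : 0 ≤ (((ρ : ℝ) + 1) / ((R : ℝ) - 1)) ^ 3 := by
    have h1R : (1 : ℝ) ≤ R := by exact_mod_cast hR1
    have hρ0 : (0 : ℝ) ≤ ρ := by exact_mod_cast hρ
    exact pow_nonneg (div_nonneg (add_nonneg hρ0 zero_le_one) (sub_nonneg.mpr h1R)) 3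
  have hA0 : 0 ≤ (2 : ℝ) ^ 3 * (1 + 56 * ((3 : ℕ) : ℝ)) ^ 3 * (8 * (((3 : ℕ) : ℝ) + 1)) ^ (3 + 1) := by positivity
  have hC0 : 0 ≤ ((3 : ℕ) : ℝ) * ((2 + 4 * ((3 : ℕ) : ℝ)) ^ 2 * ((3 : ℕ) : ℝ) * (21 : ℝ) ^ 3) * (((2 : ℕ) : ℝ) + (3 : ℕ) + 1) ^ 3 := by positivity
  have hbook := oneStep_bookkeeping (sl := sl) two_mul_decayConst_three_le hA0 mollifierConst_three_le hC0 hf0 hER hER0 hEU hEU0 hη0 hη4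
  rw [hden] at h
  exact h.trans hbook

end Summit.QuantumFields.YangMills.Theorems.PoincareLipschitzSphereMapSmallEnergyMollified
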